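import Mathlib
import HarnessLib
import Summits.HubbardSuperconductivity.HubbardSuperconductivity.Theorems.KLProgrammeKLRegimeSplitPredicatesV3

/-!
# Route `KLProgramme` — K3 child `KLRegimeBetaSplit` (stmt-HubbardSuperconductivity-19635), line `birth`, Stub 3:
# (B2-v3) the ISOTROPIC endpoint norm line from the value bound and (E5-v3) `IsoTupleL1At`

Supplier row «(B2-v3) `EndpointNormLineIso n` ⇐ value line ⇒ (E5-v3) `IsoTupleL1At n`» of the V3 map
(`KLProgrammeKLRegimeSplitPredicatesV3`): read (E5-v3) at its own resolution `m = n`, where the sectorised scale-`n` kernel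
`klIsoKernelAt … n n` IS D1's `klLegKernel … n 4` (`klIsoKernelAt_self`, `rfl`), with a uniform all-spin bound `B` on the
running coupling values; the constant inequality `CF·B + CF·(Klam U)² ≤ Klam·|U|` (child 1's choice `Klam = 4·CF + 5`, `U ≤ U₀`)
turns (E5-v3)'s right-hand side into (2.71a)'s `Klam·|U|`.  Pure packaging.  Cell gate-hubbard-kl, seat hubbard-kl-r2d-p1 (g0);
registered stub of the skeleton `Lines/birth.lean` of 19635.
-/

noncomputable section

namespace Summit.HubbardSuperconductivity.HubbardSuperconductivity.Theorems.KLRegimeSplit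

set_option linter.dupNamespace false -- summit = problem name (single-conjunct summit), D-0017

open Literature.MathematicalPhysics.QuantumLattice Literature.Probability.LatticeModels
open Summit.HubbardSuperconductivity.HubbardSuperconductivity.Theorems.KLProgrammeLegKernels

/-- **Stub 3 of line `birth` (child `KLRegimeBetaSplit`): (B2-v3) from (E5-v3).**  If the scale-`n` running coupling values are
bounded by `B ≥ 0` on the ball (all spins), (E5-v3) `IsoTupleL1At … n` holds and `CF·B + CF·(Klam U)² ≤ Klam·|U|`, then
`EndpointNormLineIso … n`: for every isotropic label 4-tuple of BGM's conservation set and every pinned point the fixed-tuple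
`L¹` size of the scale-`n` quartic kernel is `≤ Klam·|U|`. -/
theorem stub_endpointNormLineIso :
    ∀ (L M : ℕ) [NeZero L] [NeZero M] (G : GeoConsts) (P : SplitConsts) (β U μ : ℝ) (K : TrigPolyC4v) (n : ℕ) (B : ℝ),
      0 ≤ B →
        (∀ (σ σ' : Fin 2), ∀ k₁ ∈ klBall L μ K, ∀ k₂ ∈ klBall L μ K, ∀ k₃ ∈ klBall L μ K,
            ‖klQuarticValue L M β U μ K n σ σ' k₁ k₂ k₃‖ ≤ B) →
          IsoTupleL1At L M G P β U μ K n → G.CF * B + G.CF * (P.Klam * U) ^ 2 ≤ P.Klam * |U| →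
            EndpointNormLineIso L M P β U μ K n := by
  intro L M _ _ G P β U μ K n B hB hval hIso hconst Ω hΩ x₁
  have h := hIso B hB hval n le_rfl Ω hΩ x₁
  rw [klIsoKernelAt_self] at h
  exact h.trans hconst

end Summit.HubbardSuperconductivity.HubbardSuperconductivity.Theorems.KLRegimeSplit

end
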